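import Mathlib
import Literature.Analysis.FluidPDE.SereginZajaczkowski2007SwirlPressure
import HarnessLib

/-!
# Crux E `PowerGaugeEulerLiouville` (stmt-NavierStokesRegularity-19832): tools for PRESSURE SLAVING
# (lane «pressure slaving», LEAD ns-typeII-p2 g11 10:21:09Z (4) / 10:28:47Z (a); width seat ns-ezl-w3 g2)

Route `EulerZoomLiouville` (NavierStokesRegularity), crux E = Seregin's power-gauged ancient Euler class.  Two abstract tools
used by `…PressureSlaving.lean` (the pressure of an exactly self-similar member is a.e. the self-similar ansatz of a profile):

* `PressureSlaving.setIntegral_sub_mul_divergence_eq_zero` — **two pressures of one velocity**: if `(u, p)` and `(u, q)` are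
  distributional Navier–Stokes/Euler solutions (no force) on an open space–time region `Q`, then `∫∫_Q (p − q) div ψ = 0` for
  every vector test field `ψ` on `Q` (subtract the two momentum identities; all terms are integrable by the tree's
  `SereginZajaczkowski2007.integrableOn_nsVPart` / `integrableOn_pressure_mul_divergence`).  With the tree's
  `exists_measurable_gauge_of_forall_integral_mul_divergence_eq_zero` (Rusin–Šverák) this makes `p − q` a function of time a.e.
* `PressureSlaving.ae_eq_zero_of_ae_const_of_cylinderGrowth` — **the `D`-gauge kills functions of time**: a function `F` on the
  slab `(−∞,0) × ℝ³` which is a.e. constant on a.e. slice and has `∫∫_{Q_a(0)} ‖F‖^r ≤ C a^m` for all large `a` with an exponent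
  `m < 3` vanishes a.e. (on `Q_N`, `∫∫_{Q_N} ‖F‖^r = (N/a)³ ∫_{−N²}^{0} ∫_{B_a} ‖F‖^r ≤ (N/a)³ C a^m → 0` as `a → ∞`).  The crux's
  `D`-gauge `a^{2ρ} D(a; p) ≤ c` is the case `r = 3/2`, `m = 2 − 2ρ`.

WHAT THIS IS NOT: not NS regularity, not the crux E — measure-theoretic bookkeeping for the census of the crux CLASS 19832 on the
MODEL lattice; `--supports` stmt-19832.  [folklore; RusinSverak2011 §2 p. 4 (pressure determined up to a function of time);
AlbrittonBarker2019 §1 (the quantity `D` does not see functions of time — here in the sharper form: with growth `m < 3` it kills them)]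
-/

noncomputable section

-- flat `Theorems/<Route><Decl>…` files of one crux share the namespace of the crux (tree convention: `Summit.<S>.<S>.…`)
set_option linter.dupNamespace false

open MeasureTheory Set Filter Topology Metric Function TopologicalSpace
open scoped ENNReal NNReal InnerProductSpace RealInnerProductSpace

namespace Summit.NavierStokesRegularity.NavierStokesRegularity.Theorems.PowerGaugeEulerLiouville

open Literature.Analysis Literature.Analysis.FunctionSpaces Literature.Analysis.FluidPDE

namespace PressureSlaving

/-! ### Two pressures of one velocity -/

/-- **Two pressures of one velocity differ by a distributional spatial constant.**  If `(u, p)` and `(u, q)` are distributional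
Navier–Stokes solutions (viscosity `ν`, no force) on the open region `Q ⊆ ℝ × ℝ³` with the SAME velocity, then
`∫∫_Q (p − q) div ψ = 0` for every vector space–time test field `ψ` on `Q`. [folklore; RusinSverak2011 §2 p. 4] -/
theorem setIntegral_sub_mul_divergence_eq_zero {Q : Opens (ℝ × EuclideanSpace ℝ (Fin 3))} {ν : ℝ}
    {u : ℝ → EuclideanSpace ℝ (Fin 3) → EuclideanSpace ℝ (Fin 3)} {p q : ℝ → EuclideanSpace ℝ (Fin 3) → ℝ}
    (hp : IsDistributionalNSSolutionOn Q ν 0 u p) (hq : IsDistributionalNSSolutionOn Q ν 0 u q)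
    {ψ : ℝ → EuclideanSpace ℝ (Fin 3) → EuclideanSpace ℝ (Fin 3)} (hψ : IsSpaceTimeTestOn Q ψ) :
    ∫ z in (Q : Set (ℝ × EuclideanSpace ℝ (Fin 3))),
      (p z.1 z.2 - q z.1 z.2) * VectorCalculus.divergence (ψ z.1) z.2 = 0 := by
  set N : ℝ × EuclideanSpace ℝ (Fin 3) → ℝ := SereginZajaczkowski2007.nsVPart ν u ψ with hN
  set D : ℝ × EuclideanSpace ℝ (Fin 3) → ℝ := fun z => VectorCalculus.divergence (ψ z.1) z.2 with hD
  have hNi : IntegrableOn N (Q : Set (ℝ × EuclideanSpace ℝ (Fin 3))) volume :=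
    SereginZajaczkowski2007.integrableOn_nsVPart hp hψ
  have hPi : IntegrableOn (fun z : ℝ × EuclideanSpace ℝ (Fin 3) => p z.1 z.2 * D z)
      (Q : Set (ℝ × EuclideanSpace ℝ (Fin 3))) volume :=
    SereginZajaczkowski2007.integrableOn_pressure_mul_divergence hp hψ
  have hQi : IntegrableOn (fun z : ℝ × EuclideanSpace ℝ (Fin 3) => q z.1 z.2 * D z)
      (Q : Set (ℝ × EuclideanSpace ℝ (Fin 3))) volume :=
    SereginZajaczkowski2007.integrableOn_pressure_mul_divergence hq hψ
  have hQm : MeasurableSet (Q : Set (ℝ × EuclideanSpace ℝ (Fin 3))) := Q.isOpen.measurableSet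
  have e1 : ∫ z in (Q : Set (ℝ × EuclideanSpace ℝ (Fin 3))), (N z + p z.1 z.2 * D z) = 0 := by
    rw [← hp.2.2.2.2 ψ hψ]
    refine setIntegral_congr_fun hQm fun z _ => ?_
    simp only [hN, SereginZajaczkowski2007.nsVPart, hD, Pi.zero_apply, inner_zero_left, add_zero]
  have e2 : ∫ z in (Q : Set (ℝ × EuclideanSpace ℝ (Fin 3))), (N z + q z.1 z.2 * D z) = 0 := by
    rw [← hq.2.2.2.2 ψ hψ]
    refine setIntegral_congr_fun hQm fun z _ => ?_
    simp only [hN, SereginZajaczkowski2007.nsVPart, hD, Pi.zero_apply, inner_zero_left, add_zero]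
  calc ∫ z in (Q : Set (ℝ × EuclideanSpace ℝ (Fin 3))), (p z.1 z.2 - q z.1 z.2) * D z
      = ∫ z in (Q : Set (ℝ × EuclideanSpace ℝ (Fin 3))),
          ((N z + p z.1 z.2 * D z) - (N z + q z.1 z.2 * D z)) := by
        refine setIntegral_congr_fun hQm fun z _ => ?_
        ring
    _ = (∫ z in (Q : Set (ℝ × EuclideanSpace ℝ (Fin 3))), (N z + p z.1 z.2 * D z)) -
          ∫ z in (Q : Set (ℝ × EuclideanSpace ℝ (Fin 3))), (N z + q z.1 z.2 * D z) :=
        integral_sub (hNi.add hPi) (hNi.add hQi)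
    _ = 0 := by rw [e1, e2, sub_zero]

/-! ### The `D`-gauge kills functions of time -/

/-- Lebesgue measure on a product set is the product of the restricted measures. [folklore] -/
theorem volume_restrict_prod (I : Set ℝ) (B : Set (EuclideanSpace ℝ (Fin 3))) :
    ((volume : Measure (ℝ × EuclideanSpace ℝ (Fin 3))).restrict (I ×ˢ B)) =
      ((volume : Measure ℝ).restrict I).prod ((volume : Measure (EuclideanSpace ℝ (Fin 3))).restrict B) := by
  rw [Measure.volume_eq_prod, ← Measure.prod_restrict]

/-- Volume of a ball in `ℝ³` as a multiple of the unit ball. [folklore] -/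
theorem volume_ball_eq (R : ℝ) (hR : 0 < R) :
    (volume : Measure (EuclideanSpace ℝ (Fin 3))) (ball 0 R) =
      ENNReal.ofReal (R ^ 3) * (volume : Measure (EuclideanSpace ℝ (Fin 3))) (ball 0 1) := by
  rw [Measure.addHaar_ball_of_pos _ _ hR, finrank_euclideanSpace_fin]

/-- On an a.e.-constant slice the ball integrals of `‖F‖^r` scale like the volume of the ball:
`∫_{B_N} ‖F(t)‖^r = (N/a)³ ∫_{B_a} ‖F(t)‖^r`. [folklore] -/
theorem setLIntegral_ball_eq_of_ae_const {F : EuclideanSpace ℝ (Fin 3) → ℝ} {κ : ℝ} (r : ℝ)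
    (h : ∀ᵐ x ∂(volume : Measure (EuclideanSpace ℝ (Fin 3))), F x = κ) {N a : ℝ} (hN : 0 < N) (ha : 0 < a) :
    ∫⁻ x in ball (0 : EuclideanSpace ℝ (Fin 3)) N, ‖F x‖ₑ ^ r =
      ENNReal.ofReal ((N / a) ^ 3) * ∫⁻ x in ball (0 : EuclideanSpace ℝ (Fin 3)) a, ‖F x‖ₑ ^ r := by
  have hc : ∀ R : ℝ, ∫⁻ x in ball (0 : EuclideanSpace ℝ (Fin 3)) R, ‖F x‖ₑ ^ r =
      ‖κ‖ₑ ^ r * (volume : Measure (EuclideanSpace ℝ (Fin 3))) (ball 0 R) := by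
    intro R
    rw [← setLIntegral_const]
    refine lintegral_congr_ae ?_
    filter_upwards [ae_restrict_of_ae h] with x hx
    rw [hx]
  rw [hc N, hc a, volume_ball_eq N hN, volume_ball_eq a ha]
  have e : ENNReal.ofReal (N ^ 3) = ENNReal.ofReal ((N / a) ^ 3) * ENNReal.ofReal (a ^ 3) := by
    rw [← ENNReal.ofReal_mul (by positivity)]
    congr 1
    field_simp
  rw [e]
  ring

/-- **THE `D`-GAUGE KILLS FUNCTIONS OF TIME.**  Let `F` be a.e.-strongly measurable on the slab `(−∞,0) × ℝ³`, a.e. constant on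
a.e. slice (`F(t, ·) = κ_t` a.e., for a.e. `t < 0`), and suppose `∫∫_{Q_a(0)} ‖F‖^r ≤ C a^m` for all `a ≥ a₀`, with `r > 0` and an
exponent `m < 3`.  Then `F = 0` a.e. on the slab.  (For `a ≥ N`: `∫∫_{Q_N} ‖F‖^r = (N/a)³ ∫_{−N²}^0 ∫_{B_a} ‖F‖^r ≤ (N/a)³ K a^m → 0`.)
In the crux class (`a^{2ρ} D(a; ·) ≤ c`, `D(a; p) = a⁻² ∫∫_{Q_a} |p|^{3/2}`): `r = 3/2`, `m = 2 − 2ρ < 3`. [folklore; AlbrittonBarker2019 §1] -/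
theorem ae_eq_zero_of_ae_const_of_cylinderGrowth {F : ℝ → EuclideanSpace ℝ (Fin 3) → ℝ} {r : ℝ} (hr : 0 < r)
    (hFm : AEStronglyMeasurable (uncurry F)
      (volume.restrict (Iio (0 : ℝ) ×ˢ (univ : Set (EuclideanSpace ℝ (Fin 3))))))
    (hconst : ∀ᵐ t ∂(volume.restrict (Iio (0 : ℝ))), ∃ κ : ℝ,
      ∀ᵐ x ∂(volume : Measure (EuclideanSpace ℝ (Fin 3))), F t x = κ)
    {K : ℝ≥0∞} (hK : K ≠ ⊤) {m a₀ : ℝ} (hm : m < 3)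
    (hgrowth : ∀ a : ℝ, a₀ ≤ a →
      ∫⁻ z in parabolicCylinder a (0 : ℝ × EuclideanSpace ℝ (Fin 3)), ‖F z.1 z.2‖ₑ ^ r ≤ K * ENNReal.ofReal (a ^ m)) :
    ∀ᵐ z ∂(volume.restrict (Iio (0 : ℝ) ×ˢ (univ : Set (EuclideanSpace ℝ (Fin 3))))), F z.1 z.2 = 0 := by
  set f : ℝ × EuclideanSpace ℝ (Fin 3) → ℝ≥0∞ := fun z => ‖F z.1 z.2‖ₑ ^ r with hf
  -- the backward cylinder `Q_R(0) = (−R², 0) × B(0, R)`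
  have parabolicCylinder_zero : ∀ R : ℝ, parabolicCylinder R (0 : ℝ × EuclideanSpace ℝ (Fin 3)) =
      Ioo (-R ^ 2) 0 ×ˢ ball (0 : EuclideanSpace ℝ (Fin 3)) R := fun R => by
    rw [parabolicCylinder]
    simp only [Prod.fst_zero, Prod.snd_zero, zero_sub]
  have hfm : AEMeasurable f (volume.restrict (Iio (0 : ℝ) ×ˢ (univ : Set (EuclideanSpace ℝ (Fin 3))))) :=
    (hFm.aemeasurable.enorm.pow_const r)
  -- the cylinders lie in the slab
  have hQsub : ∀ R : ℝ, Ioo (-R ^ 2) 0 ×ˢ ball (0 : EuclideanSpace ℝ (Fin 3)) R ⊆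
      Iio (0 : ℝ) ×ˢ (univ : Set (EuclideanSpace ℝ (Fin 3))) := fun R =>
    prod_mono (fun t ht => ht.2) (subset_univ _)
  have hfmQ : ∀ R : ℝ, AEMeasurable f
      (((volume : Measure ℝ).restrict (Ioo (-R ^ 2) 0)).prod
        ((volume : Measure (EuclideanSpace ℝ (Fin 3))).restrict (ball 0 R))) := fun R => by
    rw [← volume_restrict_prod]
    exact hfm.mono_measure (Measure.restrict_mono (hQsub R) le_rfl)
  -- Tonelli on the cylinders
  have htonelli : ∀ R : ℝ, ∫⁻ z in parabolicCylinder R (0 : ℝ × EuclideanSpace ℝ (Fin 3)), f z =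
      ∫⁻ t in Ioo (-R ^ 2) 0, ∫⁻ x in ball (0 : EuclideanSpace ℝ (Fin 3)) R, f (t, x) := fun R => by
    rw [parabolicCylinder_zero, volume_restrict_prod, lintegral_prod _ (hfmQ R)]
  -- ## Step 1: the bound `∫∫_{Q_N} ‖F‖^r ≤ (N/a)³ C a^m` for `a ≥ max a₀ N`
  have hbound : ∀ N : ℝ, 0 < N → ∀ a : ℝ, a₀ ≤ a → N ≤ a →
      ∫⁻ z in parabolicCylinder N (0 : ℝ × EuclideanSpace ℝ (Fin 3)), f z ≤
        K * ENNReal.ofReal ((N / a) ^ 3 * a ^ m) := by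
    intro N hN a ha hNa
    have ha0 : 0 < a := hN.trans_le hNa
    -- slicewise scaling on the a.e.-constant slices
    have hslice : ∀ᵐ t ∂((volume : Measure ℝ).restrict (Ioo (-N ^ 2) 0)),
        ∫⁻ x in ball (0 : EuclideanSpace ℝ (Fin 3)) N, f (t, x) =
          ENNReal.ofReal ((N / a) ^ 3) * ∫⁻ x in ball (0 : EuclideanSpace ℝ (Fin 3)) a, f (t, x) := by
      have h' : ∀ᵐ t ∂((volume : Measure ℝ).restrict (Ioo (-N ^ 2) 0)), ∃ κ : ℝ,
          ∀ᵐ x ∂(volume : Measure (EuclideanSpace ℝ (Fin 3))), F t x = κ :=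
        ae_restrict_of_ae_restrict_of_subset (fun t ht => ht.2) hconst
      filter_upwards [h'] with t ht
      obtain ⟨κ, hκ⟩ := ht
      exact setLIntegral_ball_eq_of_ae_const r hκ hN ha0
    calc ∫⁻ z in parabolicCylinder N (0 : ℝ × EuclideanSpace ℝ (Fin 3)), f z
        = ∫⁻ t in Ioo (-N ^ 2) 0, ∫⁻ x in ball (0 : EuclideanSpace ℝ (Fin 3)) N, f (t, x) := htonelli N
      _ = ∫⁻ t in Ioo (-N ^ 2) 0,
            ENNReal.ofReal ((N / a) ^ 3) * ∫⁻ x in ball (0 : EuclideanSpace ℝ (Fin 3)) a, f (t, x) :=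
          lintegral_congr_ae hslice
      _ = ENNReal.ofReal ((N / a) ^ 3) *
            ∫⁻ t in Ioo (-N ^ 2) 0, ∫⁻ x in ball (0 : EuclideanSpace ℝ (Fin 3)) a, f (t, x) :=
          lintegral_const_mul' _ _ ENNReal.ofReal_ne_top
      _ ≤ ENNReal.ofReal ((N / a) ^ 3) *
            ∫⁻ t in Ioo (-a ^ 2) 0, ∫⁻ x in ball (0 : EuclideanSpace ℝ (Fin 3)) a, f (t, x) := by
          exact mul_le_mul_right (lintegral_mono_set (Ioo_subset_Ioo (by nlinarith) le_rfl)) _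
      _ = ENNReal.ofReal ((N / a) ^ 3) * ∫⁻ z in parabolicCylinder a (0 : ℝ × EuclideanSpace ℝ (Fin 3)), f z := by
          rw [htonelli a]
      _ ≤ ENNReal.ofReal ((N / a) ^ 3) * (K * ENNReal.ofReal (a ^ m)) := by
          gcongr
          exact hgrowth a ha
      _ = K * ENNReal.ofReal ((N / a) ^ 3 * a ^ m) := by
          rw [ENNReal.ofReal_mul (by positivity)]
          ring
  -- ## Step 2: the bound tends to `0`, so `∫∫_{Q_N} ‖F‖^r = 0`
  have hzero : ∀ N : ℝ, 0 < N → ∫⁻ z in parabolicCylinder N (0 : ℝ × EuclideanSpace ℝ (Fin 3)), f z = 0 := by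
    intro N hN
    have hlim : Tendsto (fun a : ℝ => K * ENNReal.ofReal ((N / a) ^ 3 * a ^ m)) atTop (𝓝 0) := by
      have h1 : Tendsto (fun a : ℝ => a ^ (-(3 - m))) atTop (𝓝 0) := tendsto_rpow_neg_atTop (by linarith)
      have h2 : Tendsto (fun a : ℝ => N ^ 3 * a ^ (-(3 - m))) atTop (𝓝 (N ^ 3 * 0)) :=
        h1.const_mul _
      rw [mul_zero] at h2
      have h3 : (fun a : ℝ => ENNReal.ofReal ((N / a) ^ 3 * a ^ m)) =ᶠ[atTop]
          fun a : ℝ => ENNReal.ofReal (N ^ 3 * a ^ (-(3 - m))) := by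
        filter_upwards [eventually_gt_atTop (0 : ℝ)] with a ha
        congr 1
        rw [div_pow, show -(3 - m) = m - ((3 : ℕ) : ℝ) by norm_num, Real.rpow_sub ha, Real.rpow_natCast]
        field_simp
      have h4 : Tendsto (fun a : ℝ => ENNReal.ofReal ((N / a) ^ 3 * a ^ m)) atTop (𝓝 0) := by
        rw [tendsto_congr' h3, ← ENNReal.ofReal_zero]
        exact ENNReal.tendsto_ofReal h2
      have h5 := ENNReal.Tendsto.const_mul h4 (Or.inr hK)
      rwa [mul_zero] at h5
    refine le_antisymm (ge_of_tendsto hlim ?_) bot_le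
    filter_upwards [eventually_ge_atTop a₀, eventually_ge_atTop N] with a ha hNa
    exact hbound N hN a ha hNa
  -- ## Step 3: `F = 0` a.e. on each `Q_N`, hence on the slab
  have hQN : ∀ N : ℝ, 0 < N → ∀ᵐ z ∂(volume.restrict (Ioo (-N ^ 2) 0 ×ˢ ball (0 : EuclideanSpace ℝ (Fin 3)) N)),
      F z.1 z.2 = 0 := by
    intro N hN
    have h0 := hzero N hN
    rw [parabolicCylinder_zero] at h0
    have hfm' : AEMeasurable f (volume.restrict (Ioo (-N ^ 2) 0 ×ˢ ball (0 : EuclideanSpace ℝ (Fin 3)) N)) :=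
      hfm.mono_measure (Measure.restrict_mono (hQsub N) le_rfl)
    have h1 := (lintegral_eq_zero_iff' hfm').1 h0
    filter_upwards [h1] with z hz
    have hz' : ‖F z.1 z.2‖ₑ ^ r = 0 := hz
    rcases ENNReal.rpow_eq_zero_iff.1 hz' with h | h
    · exact enorm_eq_zero.1 h.1
    · exact absurd h.2 (not_lt.2 hr.le)
  have hcover : Iio (0 : ℝ) ×ˢ (univ : Set (EuclideanSpace ℝ (Fin 3))) ⊆
      ⋃ n : ℕ, Ioo (-((n : ℝ) + 1) ^ 2) 0 ×ˢ ball (0 : EuclideanSpace ℝ (Fin 3)) ((n : ℝ) + 1) := by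
    rintro ⟨t, x⟩ hz
    have ht : t < 0 := hz.1
    obtain ⟨n, hn⟩ := exists_nat_gt (max (-t) ‖x‖)
    refine mem_iUnion.2 ⟨n, mem_prod.2 ⟨⟨?_, ht⟩, ?_⟩⟩
    · have h1 : -t < (n : ℝ) + 1 := by linarith [le_max_left (-t) ‖x‖]
      nlinarith [neg_pos.2 ht]
    · rw [mem_ball_zero_iff]
      linarith [le_max_right (-t) ‖x‖]
  refine ae_restrict_of_ae_restrict_of_subset hcover ((ae_restrict_iUnion_iff _ _).2 fun n => ?_)
  exact hQN ((n : ℝ) + 1) (by positivity)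

end PressureSlaving

end Summit.NavierStokesRegularity.NavierStokesRegularity.Theorems.PowerGaugeEulerLiouville

end
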